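import Summits.Ventures.DiscreteObjects.UnitDistance.SpectralUnitBall
import Summits.Ventures.DiscreteObjects.UnitDistance.ValuationRingReduction
import Summits.Ventures.DiscreteObjects.UnitDistance.PadicReduction
import Summits.Ventures.DiscreteObjects.UnitDistance.MoserLocalData
import Mathlib.NumberTheory.Padics.RingHoms

/-!
# Madore's reduction for RAMIFIED quadratic extensions `ℚ_p(√c)`, `‖c‖ = 1/p`, any prime `p ≡ 3 (mod 4)`
(cell `pub-namedobj`, target (U), seat udg g11)

Framing (verbatim for the cell): lottery ticket; floor = certified bounds/negative ranges.

Generalises `ThreeAdicReduction` (the case `p = 3`, kept for its `frame3 / frame6` API) to an arbitrary prime `p`: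
inside `Ω = \overline{ℚ_p}` with Mathlib's spectral norm, a `Frame p` is `g` with `g² = c ∈ ℚ_p`, `‖c‖ = 1/p` (so
`L = ℚ_p(g)` is a ramified quadratic extension, residue field `𝔽_p`).  Because `‖a‖ ∈ p^ℤ` and `‖b g‖ ∈ p^{ℤ−1/2}` never
coincide, `‖a + b g‖ = max(‖a‖, ‖b‖‖g‖)` (`spN_pair`); hence the unit ball of `L` is `{a + b g : a, b ∈ ℤ_p}` (a
`ValuationSubring`, `Frame.O`) and `a + b g ↦ a mod p` is a ring homomorphism `O → ZMod p` killing the maximal ideal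
(`Frame.resHom`, `Frame.residueToZMod`).  With udg g5's `colorable_of_valuationSubring_of_ringHom` (Madore 2015 Prop. 3.1):
for `p ≡ 3 (mod 4)` every graph with coordinates in `L` and unit-quadrance edges is `n`-colourable as soon as
`unitCircleGraph (ZMod p)` is (`Frame.colorable`) — `χ(L²) ≤ χ(UD(𝔽_p²))`: `3, 4, 5, 5` for `p = 3, 7, 11, 19` (kernel
colourings of `FiniteFieldColourings` / `FiniteFieldObstruction`).  The two frames `g² = p` and `g² = −p` (the two ramified
quadratic extensions of `ℚ_p` for `p ≡ 3 mod 4`) exist trivially.  Census use (`PadicCriterion`): Heule's field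
`ℚ(√3, √5, √11) ⊂ ℚ₁₁(√11)` has `χ ≤ 5` — no 6-chromatic unit-distance graph lives in it.  Nothing here is literature.
-/

noncomputable section

namespace Summit.Ventures.DiscreteObjects.UnitDistance.Ramified

open Spectral IntermediateField IsLocalRing
open scoped IntermediateField

variable (p : ℕ) [Fact p.Prime]

/-- An algebraic closure of `ℚ_p`. -/
abbrev Ω : Type := AlgebraicClosure ℚ_[p]

/-- `Ω` has characteristic zero. -/
instance : CharZero (Ω p) := charZero_of_injective_algebraMap (algebraMap ℚ_[p] (Ω p)).injective

/-! ## Norms in `ℚ_p` -/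

/-- `1 < p` as reals. -/
theorem one_lt_prime : (1 : ℝ) < p := by exact_mod_cast (Fact.out : p.Prime).one_lt

/-- Norms of nonzero `p`-adic numbers are integral powers of `p`. -/
theorem exists_norm_eq_zpow {c : ℚ_[p]} (hc : c ≠ 0) : ∃ a : ℤ, ‖c‖ = (p : ℝ) ^ a :=
  ⟨-c.valuation, by rw [Padic.norm_eq_zpow_neg_valuation hc]⟩

/-! ## Frames: `g² = c`, `‖c‖ = 1/p` -/

/-- A RAMIFIED QUADRATIC FRAME over `ℚ_p`: `g ∈ Ω` with `g² = c ∈ ℚ_p` of norm `1/p`. -/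
structure Frame where
  /-- the generator -/
  g : Ω p
  /-- its square, in `ℚ_p` -/
  c : ℚ_[p]
  /-- `g² = c` -/
  hg : g ^ 2 = algebraMap ℚ_[p] (Ω p) c
  /-- `‖c‖ = 1/p` -/
  hc : ‖c‖ = (p : ℝ)⁻¹

variable {p} (F : Frame p)

/-- `‖g‖² = 1/p`. -/
theorem Frame.spN_g_sq : spN ℚ_[p] F.g ^ 2 = (p : ℝ)⁻¹ := by
  rw [← spN_pow, F.hg, spN_algebraMap, F.hc]

/-- `‖g‖ > 0`. -/
theorem Frame.spN_g_pos : 0 < spN ℚ_[p] F.g := by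
  have h := F.spN_g_sq
  have h0 := spN_nonneg ℚ_[p] F.g
  have hp : (0 : ℝ) < (p : ℝ)⁻¹ := inv_pos.2 (by linarith [one_lt_prime p])
  by_contra hle
  have : spN ℚ_[p] F.g = 0 := le_antisymm (not_lt.1 hle) h0
  rw [this] at h
  rw [← h] at hp
  norm_num at hp

/-- VALUE GROUPS DIFFER: for nonzero `a, b ∈ ℚ_p`, `‖a‖ ≠ ‖b‖·‖g‖` (`p^{2m} ≠ p^{2n−1}`). -/
theorem Frame.norm_ne {a b : ℚ_[p]} (ha : a ≠ 0) (hb : b ≠ 0) : ‖a‖ ≠ ‖b‖ * spN ℚ_[p] F.g := by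
  obtain ⟨m, hm⟩ := exists_norm_eq_zpow p ha
  obtain ⟨n, hn⟩ := exists_norm_eq_zpow p hb
  have hp0 : (p : ℝ) ≠ 0 := by linarith [one_lt_prime p]
  intro h
  have hsq : ‖a‖ ^ 2 = ‖b‖ ^ 2 * spN ℚ_[p] F.g ^ 2 := by rw [h]; ring
  rw [F.spN_g_sq, hm, hn] at hsq
  have e1 : ((p : ℝ) ^ m) ^ 2 = (p : ℝ) ^ (2 * m) := by
    rw [← zpow_natCast ((p : ℝ) ^ m) 2, ← zpow_mul, mul_comm]; norm_num
  have e2 : ((p : ℝ) ^ n) ^ 2 * (p : ℝ)⁻¹ = (p : ℝ) ^ (2 * n - 1) := by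
    rw [← zpow_natCast ((p : ℝ) ^ n) 2, ← zpow_mul, ← zpow_neg_one, ← zpow_add₀ hp0]
    congr 1; push_cast; ring
  rw [e1, e2] at hsq
  have := zpow_right_injective₀ (by linarith [one_lt_prime p]) (ne_of_gt (one_lt_prime p)) hsq
  omega

/-- THE NORM FORMULA: `‖a + b·g‖ = max(‖a‖, ‖b‖·‖g‖)` for `a, b ∈ ℚ_p`. -/
theorem Frame.spN_pair (a b : ℚ_[p]) :
    spN ℚ_[p] (algebraMap ℚ_[p] (Ω p) a + algebraMap ℚ_[p] (Ω p) b * F.g) = max ‖a‖ (‖b‖ * spN ℚ_[p] F.g) := by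
  have hA : spN ℚ_[p] (algebraMap ℚ_[p] (Ω p) a) = ‖a‖ := spN_algebraMap ℚ_[p] a
  have hB : spN ℚ_[p] (algebraMap ℚ_[p] (Ω p) b * F.g) = ‖b‖ * spN ℚ_[p] F.g := by rw [spN_mul, spN_algebraMap]
  by_cases ha : a = 0
  · subst ha
    simp only [map_zero, zero_add, norm_zero]
    rw [hB, max_eq_right (mul_nonneg (norm_nonneg b) (spN_nonneg ℚ_[p] F.g))]
  by_cases hb : b = 0
  · subst hb
    simp only [map_zero, zero_mul, add_zero, norm_zero, zero_mul]
    rw [hA, max_eq_left (norm_nonneg a)]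
  have hne : spN ℚ_[p] (algebraMap ℚ_[p] (Ω p) a) ≠ spN ℚ_[p] (algebraMap ℚ_[p] (Ω p) b * F.g) := by
    rw [hA, hB]; exact F.norm_ne ha hb
  rw [spN_add_eq_max_of_ne ℚ_[p] hne, hA, hB]

/-- UNIQUENESS OF COEFFICIENTS. -/
theorem Frame.coeffs_unique {a b a' b' : ℚ_[p]}
    (h : algebraMap ℚ_[p] (Ω p) a + algebraMap ℚ_[p] (Ω p) b * F.g =
      algebraMap ℚ_[p] (Ω p) a' + algebraMap ℚ_[p] (Ω p) b' * F.g) : a = a' ∧ b = b' := by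
  have h0 : algebraMap ℚ_[p] (Ω p) (a - a') + algebraMap ℚ_[p] (Ω p) (b - b') * F.g = 0 := by
    rw [map_sub, map_sub]; linear_combination h
  have hn := F.spN_pair (a - a') (b - b')
  rw [h0, spN_zero] at hn
  have h1 : ‖a - a'‖ ≤ 0 := by rw [hn]; exact le_max_left _ _
  have h2 : ‖b - b'‖ * spN ℚ_[p] F.g ≤ 0 := by rw [hn]; exact le_max_right _ _
  have h2' : ‖b - b'‖ ≤ 0 := by
    by_contra hpos
    push Not at hpos
    exact absurd h2 (not_le.2 (mul_pos hpos F.spN_g_pos))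
  exact ⟨sub_eq_zero.1 (norm_le_zero_iff.1 h1), sub_eq_zero.1 (norm_le_zero_iff.1 h2')⟩

/-- INTEGRALITY OF COEFFICIENTS: `‖a + b g‖ ≤ 1 ⇒ ‖a‖ ≤ 1 ∧ ‖b‖ ≤ 1` (`‖b‖ ≤ √p` forces `‖b‖ ≤ 1` in `p^ℤ`). -/
theorem Frame.norm_coeff_le_one {a b : ℚ_[p]}
    (h : spN ℚ_[p] (algebraMap ℚ_[p] (Ω p) a + algebraMap ℚ_[p] (Ω p) b * F.g) ≤ 1) : ‖a‖ ≤ 1 ∧ ‖b‖ ≤ 1 := by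
  rw [F.spN_pair] at h
  refine ⟨(le_max_left _ _).trans h, ?_⟩
  by_contra hb
  push Not at hb
  -- `‖b‖ > 1` forces `‖b‖ ≥ p` (norms are integral powers of `p`)
  have hP : (p : ℝ) ≤ ‖b‖ := by
    have hb0 : b ≠ 0 := by rintro rfl; norm_num at hb
    obtain ⟨a, ha⟩ := exists_norm_eq_zpow p hb0
    rw [ha] at hb ⊢
    have ha1 : 1 ≤ a := by
      have := (one_lt_zpow_iff_right₀ (one_lt_prime p)).1 hb
      omega
    calc (p : ℝ) = (p : ℝ) ^ (1 : ℤ) := by norm_num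
      _ ≤ (p : ℝ) ^ a := zpow_le_zpow_right₀ (one_lt_prime p).le ha1
  have hle : ‖b‖ * spN ℚ_[p] F.g ≤ 1 := (le_max_right _ _).trans h
  have h0 : 0 ≤ ‖b‖ * spN ℚ_[p] F.g := mul_nonneg (norm_nonneg b) (spN_nonneg ℚ_[p] F.g)
  have hsq : (‖b‖ * spN ℚ_[p] F.g) ^ 2 ≤ 1 := by nlinarith [hle, h0]
  rw [mul_pow, F.spN_g_sq] at hsq
  have hp0 : (0 : ℝ) < p := by linarith [one_lt_prime p]
  have hsq' : ‖b‖ ^ 2 ≤ 1 * (p : ℝ) := (mul_inv_le_iff₀ hp0).1 hsq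
  nlinarith [hP, hsq', one_lt_prime p, norm_nonneg b]

/-- `‖a + b g‖ < 1 ⇒ ‖a‖ < 1`. -/
theorem Frame.norm_fst_lt_one {a b : ℚ_[p]}
    (h : spN ℚ_[p] (algebraMap ℚ_[p] (Ω p) a + algebraMap ℚ_[p] (Ω p) b * F.g) < 1) : ‖a‖ < 1 := by
  rw [F.spN_pair] at h
  exact (le_max_left _ _).trans_lt h

/-! ## The field `L = ℚ_p(g)`, its unit ball, and the residue map to `ZMod p` -/

/-- The ramified quadratic field `L = ℚ_p(g) ⊂ Ω`. -/
def Frame.L : IntermediateField ℚ_[p] (Ω p) := ℚ_[p]⟮F.g⟯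

/-- Every element of `L` is `a + b g` with `a, b ∈ ℚ_p`. -/
theorem Frame.exists_coeffs (x : F.L) : ∃ ab : ℚ_[p] × ℚ_[p],
    (x : Ω p) = algebraMap ℚ_[p] (Ω p) ab.1 + algebraMap ℚ_[p] (Ω p) ab.2 * F.g := by
  obtain ⟨a, b, h⟩ := MoserLocal.exists_coeffs_of_mem_adjoin_simple (F := ℚ_[p]) F.hg x.2
  exact ⟨(a, b), h⟩

/-- The coefficient pair of `x ∈ L`. -/
def Frame.cf (x : F.L) : ℚ_[p] × ℚ_[p] := Classical.choose (F.exists_coeffs x)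

/-- `x = (cf x).1 + (cf x).2 · g`. -/
theorem Frame.cf_spec (x : F.L) :
    (x : Ω p) = algebraMap ℚ_[p] (Ω p) (F.cf x).1 + algebraMap ℚ_[p] (Ω p) (F.cf x).2 * F.g :=
  Classical.choose_spec (F.exists_coeffs x)

/-- The coefficient pair is determined by any representation. -/
theorem Frame.cf_eq {x : F.L} {a b : ℚ_[p]}
    (h : (x : Ω p) = algebraMap ℚ_[p] (Ω p) a + algebraMap ℚ_[p] (Ω p) b * F.g) : F.cf x = (a, b) := by
  have h' := F.cf_spec x
  rw [h] at h'
  obtain ⟨h1, h2⟩ := F.coeffs_unique h'.symm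
  exact Prod.ext h1 h2

/-- `cf n = (n, 0)` for natural numbers `n` (in particular `cf 0 = (0,0)`, `cf 1 = (1,0)`). -/
theorem Frame.cf_natCast (n : ℕ) : F.cf (n : F.L) = ((n : ℚ_[p]), 0) :=
  F.cf_eq (by simp)

/-- `cf` on sums and products: `cf (x + y) = (a + a', b + b')`, `cf (x * y) = (a a' + b b' c, a b' + a' b)`. -/
theorem Frame.cf_add_mul (x y : F.L) :
    F.cf (x + y) = ((F.cf x).1 + (F.cf y).1, (F.cf x).2 + (F.cf y).2) ∧
    F.cf (x * y) =
      ((F.cf x).1 * (F.cf y).1 + (F.cf x).2 * (F.cf y).2 * F.c, (F.cf x).1 * (F.cf y).2 + (F.cf y).1 * (F.cf x).2) := by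
  constructor
  · apply F.cf_eq
    rw [IntermediateField.coe_add, F.cf_spec x, F.cf_spec y, map_add, map_add]; ring
  · apply F.cf_eq
    rw [IntermediateField.coe_mul, F.cf_spec x, F.cf_spec y]
    simp only [map_add, map_mul]
    linear_combination (algebraMap ℚ_[p] (Ω p) (F.cf x).2) * (algebraMap ℚ_[p] (Ω p) (F.cf y).2) * F.hg

/-- THE UNIT BALL of `L` as a VALUATION SUBRING of `L`. -/
def Frame.O : ValuationSubring F.L where
  carrier := {x | spN ℚ_[p] (x : Ω p) ≤ 1}
  mul_mem' {x y} hx hy := by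
    simp only [Set.mem_setOf_eq] at hx hy ⊢
    rw [IntermediateField.coe_mul, spN_mul]
    exact mul_le_one₀ hx (spN_nonneg ℚ_[p] _) hy
  one_mem' := by simp only [Set.mem_setOf_eq, IntermediateField.coe_one, spN_one ℚ_[p]]; exact le_rfl
  add_mem' {x y} hx hy := by
    simp only [Set.mem_setOf_eq] at hx hy ⊢
    rw [IntermediateField.coe_add]
    exact (spN_add_le ℚ_[p] _ _).trans (max_le hx hy)
  zero_mem' := by simp only [Set.mem_setOf_eq, IntermediateField.coe_zero, spN_zero ℚ_[p]]; exact zero_le_one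
  neg_mem' {x} hx := by
    simp only [Set.mem_setOf_eq] at hx ⊢
    rwa [IntermediateField.coe_neg, spN_neg]
  mem_or_inv_mem' x := by
    by_cases hx : spN ℚ_[p] (x : Ω p) ≤ 1
    · exact Or.inl hx
    · right
      change spN ℚ_[p] ((x⁻¹ : F.L) : Ω p) ≤ 1
      rw [IntermediateField.coe_inv, spN_inv]
      exact inv_le_one_of_one_le₀ (le_of_lt (not_le.mp hx))

/-- Membership in `O`. -/
theorem Frame.mem_O_iff {x : F.L} : x ∈ F.O ↔ spN ℚ_[p] (x : Ω p) ≤ 1 := Iff.rfl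

/-- Elements of `O` have integral coefficients: `max ‖a‖ ‖b‖ ≤ 1`. -/
theorem Frame.norm_cf_le {x : F.L} (hx : x ∈ F.O) : max ‖(F.cf x).1‖ ‖(F.cf x).2‖ ≤ 1 := by
  rw [F.mem_O_iff, F.cf_spec x] at hx
  obtain ⟨h1, h2⟩ := F.norm_coeff_le_one hx
  exact max_le h1 h2

/-- The first coefficient of `x ∈ O`, as a `p`-adic integer. -/
def Frame.fstInt (x : F.O) : ℤ_[p] := ⟨(F.cf x.1).1, (le_max_left _ _).trans (F.norm_cf_le x.2)⟩

/-- The second coefficient of `x ∈ O`, as a `p`-adic integer. -/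
def Frame.sndInt (x : F.O) : ℤ_[p] := ⟨(F.cf x.1).2, (le_max_right _ _).trans (F.norm_cf_le x.2)⟩

/-- THE RESIDUE MAP `O → ZMod p`, `a + b g ↦ a mod p`. -/
def Frame.resHom : F.O →+* ZMod p where
  toFun x := PadicInt.toZMod (F.fstInt x)
  map_one' := by
    have h : F.fstInt 1 = 1 := by
      apply Subtype.ext
      change (F.cf ((1 : F.O) : F.L)).1 = 1
      have := F.cf_natCast 1
      rw [Nat.cast_one, Nat.cast_one] at this
      rw [OneMemClass.coe_one, this]
    rw [h, map_one]
  map_mul' x y := by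
    have hc : ‖F.c‖ ≤ 1 := by rw [F.hc]; exact inv_le_one_of_one_le₀ (one_lt_prime p).le
    have h : F.fstInt (x * y) = F.fstInt x * F.fstInt y + F.sndInt x * F.sndInt y * ⟨F.c, hc⟩ := by
      apply Subtype.ext
      change (F.cf ((x * y : F.O) : F.L)).1 = _
      rw [MulMemClass.coe_mul, (F.cf_add_mul _ _).2]
      rfl
    rw [h, map_add, map_mul, map_mul, map_mul]
    have hc0 : PadicInt.toZMod (⟨F.c, hc⟩ : ℤ_[p]) = 0 := by
      rw [← RingHom.mem_ker, PadicInt.ker_toZMod, IsLocalRing.mem_maximalIdeal, mem_nonunits_iff]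
      exact PadicInt.mem_nonunits.2 (by change ‖F.c‖ < 1; rw [F.hc]; exact inv_lt_one_of_one_lt₀ (one_lt_prime p))
    rw [hc0, mul_zero, add_zero]
  map_zero' := by
    have h : F.fstInt 0 = 0 := by
      apply Subtype.ext
      change (F.cf ((0 : F.O) : F.L)).1 = 0
      have := F.cf_natCast 0
      rw [Nat.cast_zero, Nat.cast_zero] at this
      rw [ZeroMemClass.coe_zero, this]
    rw [h, map_zero]
  map_add' x y := by
    have h : F.fstInt (x + y) = F.fstInt x + F.fstInt y := by
      apply Subtype.ext
      change (F.cf ((x + y : F.O) : F.L)).1 = _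
      rw [AddMemClass.coe_add, (F.cf_add_mul _ _).1]
      rfl
    rw [h, map_add]

/-- Elements of the maximal ideal of `O` have norm `< 1`. -/
theorem Frame.spN_lt_one_of_mem_maximalIdeal {x : F.O} (hx : x ∈ maximalIdeal F.O) :
    spN ℚ_[p] ((x : F.L) : Ω p) < 1 := by
  rcases (show spN ℚ_[p] ((x : F.L) : Ω p) ≤ 1 from x.2).lt_or_eq with hlt | heq
  · exact hlt
  · exfalso
    have hx0 : ((x : F.L) : Ω p) ≠ 0 := by
      intro h0; rw [h0, spN_zero] at heq; norm_num at heq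
    have hxL : (x : F.L) ≠ 0 := fun h0 => hx0 (by rw [h0]; rfl)
    have hinv : (x : F.L)⁻¹ ∈ F.O := by
      rw [F.mem_O_iff, IntermediateField.coe_inv, spN_inv, heq, inv_one]
    have hunit : IsUnit x := by
      refine IsUnit.of_mul_eq_one ⟨(x : F.L)⁻¹, hinv⟩ ?_
      apply Subtype.ext
      change (x : F.L) * (x : F.L)⁻¹ = 1
      exact mul_inv_cancel₀ hxL
    exact (IsLocalRing.mem_maximalIdeal _ |>.1 hx) hunit

/-- The residue map kills the maximal ideal: `𝔪_O ≤ ker (resHom)`. -/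
theorem Frame.maximalIdeal_le_ker : maximalIdeal F.O ≤ RingHom.ker F.resHom := by
  intro x hx
  have hlt := F.spN_lt_one_of_mem_maximalIdeal hx
  rw [F.cf_spec] at hlt
  have ha : ‖(F.cf (x : F.L)).1‖ < 1 := F.norm_fst_lt_one hlt
  rw [RingHom.mem_ker]
  change PadicInt.toZMod (F.fstInt x) = 0
  rw [← RingHom.mem_ker, PadicInt.ker_toZMod, IsLocalRing.mem_maximalIdeal, mem_nonunits_iff]
  exact PadicInt.mem_nonunits.2 ha

/-- THE RESIDUE FIELD OF `O` MAPS TO `ZMod p`. -/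
def Frame.residueToZMod : ResidueField F.O →+* ZMod p :=
  Ideal.Quotient.lift (maximalIdeal F.O) F.resHom fun _ hx => F.maximalIdeal_le_ker hx

/-- THE LOCAL THEOREM (Madore's `χ(L²) ≤ χ(UD(𝔽_p²))` for ramified `L = ℚ_p(g)`, `p ≡ 3 mod 4`): every graph with vertex
coordinates in `L` and unit-quadrance edges is `n`-colourable as soon as `unitCircleGraph (ZMod p)` is. -/
theorem Frame.colorable (h4 : p % 4 = 3) {n : ℕ} (hZ : (unitCircleGraph (ZMod p)).Colorable n)
    {V : Type*} {G : SimpleGraph V} (x y : V → F.L)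
    (hadj : ∀ ⦃v w : V⦄, G.Adj v w → (x v - x w) ^ 2 + (y v - y w) ^ 2 = 1) : G.Colorable n :=
  colorable_of_valuationSubring_of_ringHom F.O (fun v => (x v, y v))
    (sq_ne_neg_one_of_ringHom F.residueToZMod (zmod_sq_ne_neg_one_of_mod_four p h4)) hadj F.residueToZMod hZ

/-! ## The two ramified frames `g² = ±p` exist -/

variable (p)

/-- The frame `g² = p` (the field `ℚ_p(√p)`). -/
def framePos : Frame p :=
  ⟨Classical.choose (IsAlgClosed.exists_pow_nat_eq (algebraMap ℚ_[p] (Ω p) p) two_pos), p,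
    Classical.choose_spec (IsAlgClosed.exists_pow_nat_eq (algebraMap ℚ_[p] (Ω p) p) two_pos), Padic.norm_p⟩

/-- The frame `g² = −p` (the field `ℚ_p(√−p)`). -/
def frameNeg : Frame p :=
  ⟨Classical.choose (IsAlgClosed.exists_pow_nat_eq (algebraMap ℚ_[p] (Ω p) (-p)) two_pos), -p,
    Classical.choose_spec (IsAlgClosed.exists_pow_nat_eq (algebraMap ℚ_[p] (Ω p) (-p)) two_pos),
    by rw [norm_neg]; exact Padic.norm_p⟩

/-- `(framePos p).g ^ 2 = p`. -/
theorem framePos_g_sq : (framePos p).g ^ 2 = (p : Ω p) := by rw [(framePos p).hg]; exact map_natCast _ p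

/-- `(frameNeg p).g ^ 2 = -p`. -/
theorem frameNeg_g_sq : (frameNeg p).g ^ 2 = -(p : Ω p) := by
  rw [(frameNeg p).hg]; change algebraMap ℚ_[p] (Ω p) (-(p : ℚ_[p])) = _; rw [map_neg, map_natCast]

end Summit.Ventures.DiscreteObjects.UnitDistance.Ramified
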